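import Literature.NumberTheory.EllipticCurves.BurungaleSkinnerTianWan2024.OrdinaryMainStatementSemistableOPEN
import Literature.NumberTheory.EllipticCurves.SkinnerUrban2014.SemistableCurvesProofs
import Literature.NumberTheory.EllipticCurves.Rank1Residual.PeriodUnitProofs
import HarnessLib

/-!
# BSTW arXiv:2409.01350v2 Thm. 10.10 (a), SEMISTABLE clause — its typed OPEN binder is a CONSEQUENCE
# of refereed print already in the tree (Skinner–Urban 2014 Thm. 3.6.9 + Ribet's level-lowering +
# Serre + the Greenberg–Vatsal period unit): proofs only

A *proofs* file (theorems only: no definition, no named fact, no `sorry`), written by the ARM-P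
referee-reader `bsd-cited-r03` (cell `run/shared/lean/pub/bsd-cited/`, register row R-01 = the
`p = 3` proof-input flag `SU14-12.3.6-mu@nonsplit@3` of `skinner_urban_main_conjecture`).

## What is proved, and why it matters for the flag register

`OrdinaryMainStatementSemistableOPEN.lean` (typer `bsd-littype-01`, gen 6) types the first sentence
of Burungale–Skinner–Tian–Wan, arXiv:2409.01350v2, Thm. 10.10 (a) (p. 89, TeX label `IMC_ord`) as
the OPEN claim-tagged binder `thm1010a_mainStatement_semistable_ordinary_OPEN`: for `W/ℚ` globally
minimal and SEMISTABLE, `p ≠ 2` a prime of good ordinary reduction with `E[p]` irreducible, the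
INTEGRAL cyclotomic main conjecture in the Néron normalisation, `CharIdealEqPadicLFunctionNeron W p`.

The preprint itself says (Rem. 10.11): "Part (a) gives a different proof of a special case of
Theorem 9.21 (c)" — i.e. of the Skinner–Urban statement.  This file makes "special case" exact in
the kernel: **the binder FOLLOWS from named REFEREED facts already in the tree**, namely

* `skinner_urban_main_conjecture` (bsd.S21 = [SU14] Thm. 3.6.9, clauses (1) torsion and (3) the
  integral equality under "`ρ̄_{E,p^n}` onto for all `n`"), hypotheses (irr) + (ram);
* (ram) is AUTOMATIC for a semistable curve at an odd good prime with `E[p]` irreducible —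
  Ribet's level-lowering argument, [SU14] p. 45 (remark before Cor. 3.6.10), PROVED in the tree as
  `SkinnerUrban2014.ram_of_semistable_of_irr` over `exists_isNewformOf` (modularity) and
  `diamond1995_refinedSerre` (Ribet 1990 Thm. 1.1 + Diamond 1995); BSTW print the same sentence in
  their own proof template (§10.3, proof of Thm. 10.1: "Since `g` is semistable, there exists a prime
  `q ∣ N` satisfying the condition (ram) by Ribet's level raising [sic]");
* "`ρ̄_{E,p^n}` onto for all `n`" is AUTOMATIC there too — `SkinnerUrban2014.surjPow_of_semistable_of_irr`
  (Serre 1972 Prop. 21 + the (ram) transvection; tree theorems);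
* the Néron normalisation `ϖ · Ω_E = Ω⁺_f` has `ord_p ϖ = 0` at a good prime `p ≥ 3` with `E[p]`
  irreducible — `Rank1Residual.periodUnit_of_realPeriodRat_eq_unit_mul_plusPeriod` over the named
  facts `realPeriodRat_eq_unit_mul_plusPeriod` (`p ≥ 5`) and `realPeriodRat_eq_unit_mul_plusPeriod_three`
  (Greenberg–Vatsal 2000 §3 Rem. 3.4 with Mazur 1978 Cor. 4.1 / Abbes–Ullmo 1996).

The assembly is, binder for binder, the Summits-side
`Summit.BirchSwinnertonDyer.Rank1Residual.mazurMainConjecture_of_skinnerUrban_of_ram`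
(`Partition/MainConjecturesRankZeroFactsDerived.lean`; conclusion `MazurMainConjecture W p`, whose
body is `CharIdealEqPadicLFunctionNeron W p` verbatim) with its (ram) binder discharged by
`ram_of_semistable_of_irr`; it is re-run here on the Literature side so that the BSTW file's
consumers can be fed without a Summits import.

CONSEQUENCE FOR THE REGISTER (no pricing here — that is the referee desks'): as a STATEMENT the
preprint binder adds nothing at any prime to what the tree derives from refereed print; its content
is a second ROAD (zeta elements, BSTW §§5, 9.4, 10 — PREPRINT) to the same statement, which matters
exactly where the Skinner–Urban road carries a proof-input flag, i.e. at `p = 3`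
(`SU14-12.3.6-mu@nonsplit@3`, ACTIVE-PRINT-GAP).  At `p ≥ 5` the theorems below turn the OPEN
binder into a consequence of UNFLAGGED refereed facts.

Nothing here asserts the main conjecture: every theorem is CONDITIONAL on the named facts it lists
(`hSU`, `h5`, `h3`, `hmod`, `hLL`), exactly as the Partition files are.

## References
* [BurungaleSkinnerTianWan2024] arXiv:2409.01350v2, Thm. 10.10 (a) and Rem. 10.11 (p. 89; TeX
  l.7519–7533), §10.3 first sentence (TeX l.7457).
* [SkinnerUrban2014] Invent. Math. 195 (2014), Thm. 3.6.9 and the remark before Cor. 3.6.10 (p. 45 of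
  the author version `paper:doi-10-1007-s00222-013-0448-1`).
* [Ribet1990] Invent. Math. 100, Thm. 1.1; [Diamond1995RefinedSerre] Thm. 1.1.
* [GreenbergVatsal2000] Invent. Math. 142, §3 Rem. 3.4; [Mazur1978] Cor. 4.1; [AbbesUllmo1996] Thm. A.
-/

set_option autoImplicit false

noncomputable section

open scoped Classical MatrixGroups ModularForm

open CongruenceSubgroup WeierstrassCurve Literature.NumberTheory.EllipticCurves
  Literature.NumberTheory.EllipticCurves.ModularForms
  Literature.NumberTheory.EllipticCurves.Rank1Residual
  Literature.NumberTheory.EllipticCurves.SkinnerUrban2014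
  Literature.NumberTheory.Automorphic

namespace Literature.NumberTheory.EllipticCurves.BurungaleSkinnerTianWan2024

/-- **The integral cyclotomic main conjecture (Néron normalisation) for a SEMISTABLE `E/ℚ` at an
odd good ordinary prime `p` with `E[p]` irreducible, from Skinner–Urban 2014 Thm. 3.6.9** (`hSU`,
bsd.S21 as typed) with ALL its extra premises discharged on this locus: (ram) by Ribet's
level-lowering (`ram_of_semistable_of_irr`, from modularity `hmod` and `diamond1995_refinedSerre`
`hLL`), "`ρ̄_{E,p^n}` onto for all `n`" by `surjPow_of_semistable_of_irr`, and the passage from the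
`f`-normalised `L_p(f, α)` of clause (3) to `ϖ · L_p(f, α)` with `ϖ · Ω_E = Ω⁺_f` by the period unit
`ord_p ϖ = 0` (`h5`, `h3`: Greenberg–Vatsal 2000 §3 Rem. 3.4).  The conclusion is LITERALLY the
predicate `CharIdealEqPadicLFunctionNeron W p` of `CyclotomicMainStatementRankOneBSDOPEN.lean`
(= BSTW statement 9.3 (b), integral form, for `g = f_E`).  This is [SU14] p. 45, remark before
Cor. 3.6.10, with `p ≥ 11` relaxed to "`p` odd and `E[p]` irreducible" (Mazur's Thm. 4 is only used
there to get irreducibility), and it is the "special case of Theorem 9.21 (c)" that BSTW Rem. 10.11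
says Thm. 10.10 (a) re-proves.  CONDITIONAL on the five named facts; closes nothing by itself.
[cite: SkinnerUrban2014, Thm. 3.6.9 and the remark before Cor. 3.6.10 (p. 45)]
[cite: BurungaleSkinnerTianWan2024, Rem. 10.11 (p. 89) ("a different proof of a special case of Theorem 9.21 (c)")]
[cite: GreenbergVatsal2000, §3, Remark 3.4] [cite: Ribet1990, Thm. 1.1] -/
theorem charIdealEqPadicLFunctionNeron_of_skinnerUrban_of_semistable
    (hSU : ∀ (W : WeierstrassCurve ℚ) [W.IsElliptic] [W.IsGloballyMinimal] (p : ℕ) [Fact p.Prime]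
      (κ : ZpExtension ℚ p) (γ : Field.absoluteGaloisGroup ℚ) (N : ℕ) [NeZero N]
      (f : CuspForm (Gamma0 N) 2),
      skinner_urban_main_conjecture W p (κ := κ) (γ := γ) (f := f))
    (h5 : realPeriodRat_eq_unit_mul_plusPeriod) (h3 : realPeriodRat_eq_unit_mul_plusPeriod_three)
    (hmod : exists_isNewformOf) (hLL : diamond1995_refinedSerre)
    (W : WeierstrassCurve ℚ) [W.IsElliptic] [W.IsGloballyMinimal] (p : ℕ) [Fact p.Prime]
    (hp2 : p ≠ 2) (hsst : Semistable W) (hgood : W.HasGoodReductionAtPrime p)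
    (hord : ¬ (p : ℤ) ∣ W.frobeniusTrace p) (hirr : W.HasIrreducibleModPGaloisRep p) :
    CharIdealEqPadicLFunctionNeron W p := by
  intro κ γ hκ hγ hγ' _ f hf ϖ hϖ D
  have hp : p.Prime := Fact.out
  have hp3 : 3 ≤ p := by have := hp.two_le; omega
  -- (ram) by Ribet's level-lowering, `p`-adic surjectivity by Serre + the (ram) transvection
  have hram : Ram W p := ram_of_semistable_of_irr hmod hLL W p hp2 hgood hsst hirr
  have hsur : ∀ n : ℕ, W.HasSurjectiveModNGaloisRep (p ^ n : ℕ) :=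
    surjPow_of_semistable_of_irr W p hmod hLL hp2 hgood hsst hirr
  -- Skinner–Urban Thm. 3.6.9, clauses (1) and (3)
  obtain ⟨hX, -, hint⟩ := hSU W p κ γ _ f hp3 hgood hord hirr hram hκ hγ hγ' hf D
  obtain ⟨g, hιg, hchar⟩ := hint hsur
  -- the period ratio `ϖ` is a `p`-adic unit
  have hv : padicValRat p ϖ = 0 :=
    periodUnit_of_realPeriodRat_eq_unit_mul_plusPeriod h5 h3 W p hp2 hgood hirr f hf ϖ hϖ
  have hϖ0 : ϖ ≠ 0 := by
    have hpos : 0 < plusPeriod f := IsNewform0.plusPeriod_pos_holds hf.1 hf.coeffField_eq_bot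
    rintro rfl
    simp only [Rat.cast_zero, zero_mul] at hϖ
    exact absurd hϖ hpos.ne
  have hnorm : ‖((ϖ : ℚ) : ℚ_[p])‖ = 1 := by
    rw [Padic.eq_padicNorm, padicNorm.eq_zpow_of_nonzero hϖ0, hv]
    simp
  set u : ℤ_[p] := ⟨((ϖ : ℚ) : ℚ_[p]), hnorm.le⟩ with hu
  have hunit : IsUnit u := PadicInt.isUnit_iff.mpr hnorm
  refine ⟨hX, PowerSeries.C u * g, ?_, ?_⟩
  · rw [hchar]
    exact (Ideal.span_singleton_mul_left_unit (hunit.map PowerSeries.C) g).symm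
  · rw [map_mul, hιg, PowerSeries.map_C]
    rfl

/-- **BSTW Thm. 10.10 (a), SEMISTABLE clause — the typed OPEN preprint binder
`thm1010a_mainStatement_semistable_ordinary_OPEN` is a CONSEQUENCE of refereed print already in the
tree**: granted Skinner–Urban 2014 Thm. 3.6.9 (`hSU`, bsd.S21), the Greenberg–Vatsal period-unit
facts (`h5`, `h3`), modularity (`hmod`) and Ribet–Diamond level-lowering (`hLL`), the binder holds
(pointwise: `charIdealEqPadicLFunctionNeron_of_skinnerUrban_of_semistable`).  So, as a STATEMENT, the
preprint clause adds nothing at any `p ≥ 3`; what BSTW Thm. 10.10 (a) adds is a second ROAD to the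
statement (zeta elements; Rem. 10.11), relevant where the Skinner–Urban road carries a proof-input
flag (`p = 3`, `SU14-12.3.6-mu@nonsplit@3`).  CONDITIONAL; closes nothing by itself; the binder's
claim tag (status under-review) is about that road, not about this derivation.
[cite: BurungaleSkinnerTianWan2024, Thm. 10.10 (a) and Rem. 10.11 (p. 89; label IMC_ord)]
[cite: SkinnerUrban2014, Thm. 3.6.9 and the remark before Cor. 3.6.10 (p. 45)] -/
theorem thm1010a_mainStatement_semistable_ordinary_OPEN_of_skinnerUrban
    (hSU : ∀ (W : WeierstrassCurve ℚ) [W.IsElliptic] [W.IsGloballyMinimal] (p : ℕ) [Fact p.Prime]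
      (κ : ZpExtension ℚ p) (γ : Field.absoluteGaloisGroup ℚ) (N : ℕ) [NeZero N]
      (f : CuspForm (Gamma0 N) 2),
      skinner_urban_main_conjecture W p (κ := κ) (γ := γ) (f := f))
    (h5 : realPeriodRat_eq_unit_mul_plusPeriod) (h3 : realPeriodRat_eq_unit_mul_plusPeriod_three)
    (hmod : exists_isNewformOf) (hLL : diamond1995_refinedSerre) :
    thm1010a_mainStatement_semistable_ordinary_OPEN :=
  fun W _ _ p _ hp2 hsst hgood hord hirr ↦
    charIdealEqPadicLFunctionNeron_of_skinnerUrban_of_semistable hSU h5 h3 hmod hLL W p hp2 hsst hgood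
      hord hirr

/-- **The `p = 3` instance, named for the ARM-P register R-01**: for `W/ℚ` globally minimal and
semistable with good ordinary reduction at `3` and `E[3]` irreducible, the integral cyclotomic main
conjecture at `3` in the Néron normalisation (`CharIdealEqPadicLFunctionNeron W 3`) follows from
`skinner_urban_main_conjecture` AT `p = 3` — the instantiation that carries the proof-input flag
`SU14-12.3.6-mu@nonsplit@3` — with `h3`, `hmod`, `hLL`; the `p ≥ 5` period fact `h5` is carried only
because the pointwise theorem is uniform in `p`.  This is the exact locus of the preprint binder
`thm1010a_mainStatement_semistable_ordinary_OPEN` at `3`: on it the preprint's Thm. 10.10 (a) is an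
ALTERNATIVE ROAD to a statement the flagged refereed road already yields, not a new statement.
CONDITIONAL; closes nothing; no class is relabelled here.
[cite: SkinnerUrban2014, Thm. 3.6.9 (p. 45)] [cite: BurungaleSkinnerTianWan2024, Rem. 10.11 (p. 89)] -/
theorem charIdealEqPadicLFunctionNeron_three_of_skinnerUrban_of_semistable
    (hSU : ∀ (W : WeierstrassCurve ℚ) [W.IsElliptic] [W.IsGloballyMinimal] (p : ℕ) [Fact p.Prime]
      (κ : ZpExtension ℚ p) (γ : Field.absoluteGaloisGroup ℚ) (N : ℕ) [NeZero N]
      (f : CuspForm (Gamma0 N) 2),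
      skinner_urban_main_conjecture W p (κ := κ) (γ := γ) (f := f))
    (h5 : realPeriodRat_eq_unit_mul_plusPeriod) (h3 : realPeriodRat_eq_unit_mul_plusPeriod_three)
    (hmod : exists_isNewformOf) (hLL : diamond1995_refinedSerre)
    (W : WeierstrassCurve ℚ) [W.IsElliptic] [W.IsGloballyMinimal]
    (hsst : Semistable W) (hgood : W.HasGoodReductionAtPrime 3)
    (hord : ¬ ((3 : ℕ) : ℤ) ∣ W.frobeniusTrace 3) (hirr : W.HasIrreducibleModPGaloisRep 3) :
    CharIdealEqPadicLFunctionNeron W 3 :=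
  charIdealEqPadicLFunctionNeron_of_skinnerUrban_of_semistable hSU h5 h3 hmod hLL W 3 (by decide) hsst
    hgood hord hirr

end Literature.NumberTheory.EllipticCurves.BurungaleSkinnerTianWan2024

end
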